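import Summits.QuantumFields.BalabanUV.Beta.EriceRemainderEnclosureHistoryAutonomyThresholdDiscrete

/-!
# EriceRemainderEnclosureHistoryAutonomyThresholdDiscreteWitness — (E46b) THE PER-GEOMETRY THRESHOLD IS SHARP FOR `bγ² ≥ 2`: at box `γ = 1`,
# floor `b = s ≥ 2`, pin `1`, the Markov tent family `φ_{s,y}(x) = s + max((1+s)∕y² − (1+s) − (1+s)(1+y)∕y²·|√(1+s)·x − y|, 0)`,
# `y ∈ [9∕10, 1[` (witnesses already for `s ≥ 9∕7`), has zeroth moment `M_{s,y} = (1+s)√(1+s)·(1+y)∕y²` and TWO box solutions (`1∕h(m)² = 1 + m·s` and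
# `1∕h(m)² = (1+s)∕y² + (m−1)·s`), with `M_{s,y} ↓ 2(1+s)√(1+s)` as `y ↑ 1` — so (E46a)'s `memFlow_unique_of_strongAF`
# (`M·γ³ ≤ 2(1+bγ²)√(1+bγ²)` ⟹ unique) is EXACT at every geometry `bγ² = s ≥ 2`: the set of zeroth moments of non-unique instances at that
# geometry is exactly `]2(1+s)√(1+s), ∞[`; (E38c) is the case `s = 2`

Cell `pub-balaban`, β-function sub-cell, BINDER row D4 «RemainderConst leaves for Bałaban's split» (`HOME/BINDER-OWNERS.md`; owner
lineage `b2b-balaban-beta-an4`; this file by co-owner #2 lineage `b2b-balaban-beta-d4-p2`, generation 41), β-FLOW TEAM duty (1),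
FREEZE (0) honoured (def-free, no notation: the family and its two solutions are explicit lambdas; (E46a) `…HistoryAutonomyThresholdDiscrete`
BY NAME for the uniqueness side).  (E38c) `…HistoryAutonomyThresholdWitness` is the template (`s = 2`, node U2's `hSlow`); nothing of it
is restated — the statements here carry the geometry parameter `s`.

HONEST FRAMING (page 1, verbatim and binding).  *"Discharging BetaPertH makes Bałaban's UV stability UNCONDITIONAL — a real
constructive-QFT result; it is NOT the continuum limit and NOT the Clay problem."*  THIS FILE DISCHARGES NOTHING OF THE KIND.  An EXPLICIT
TOY FAMILY (elementary real algebra); nothing of Bałaban's (1.22) asserted — NOT its geometry `bγ²`, NOT its zeroth moment.  Row D4 class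
UNCHANGED (critical-path width 0; instance 0∕1; D4 DISCHARGE NO DATE).  HONEST DEPENDENCY: continuum YM on T⁴ ⇐ BetaPertH ∧ nine spine
estimates (0/9 proved); BetaPertH ⇐ (D1) ∧ (D4) ∧ CAP+tail; G-an2-4 gates asym, D1 and NE2/3/4.

WHAT IS PROVED ([folklore]; 0 `def`, 0 sorry).  Witnesses for `s ≥ 9∕7` (the choice `y ≥ 9∕10` needs `(1+s)∕(1+2s) ≤ 16∕25`; smaller `s`
would need `y` closer to 1), `9∕10 ≤ y ≤ 1` (strictly `< 1` for distinctness); the two-sided END for `s ≥ 2` ((E46a)'s side).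
 §1 the tent in the scaled variable `√(1+s)·x`: `tentS_eq_zero_of_le`, `tentS_eq_zero_of_eq_one`, `tentS_eq_of_eq`, `abs_tentS_sub_le`, `sqrtS_div_sqrt_le`.
 §2 the functional and the two solutions: `le_tentSφ` (floor `s`), `abs_tentSφ_sub_le` (Lipschitz `(1+s)√(1+s)(1+y)∕y²`), `radS_zero` ∕ `radS_succ`,
    `radF_zero` ∕ `radF_succ`, `seqBox_hS`, `seqBox_hFs`, **`memFlow_hS_tentSφ`**, **`memFlow_hFs_tentSφ`**, **`hS_ne_hFs`**.
 §3 ENDs: `moment_lt_of_gt` (the parameter choice), **`exists_two_solutions_at_geometry`** (every `s ≥ 9∕7`, every `M′ > 2(1+s)√(1+s)`: a Markov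
    functional with zeroth moment `≤ M′`, floor `s`, box ]0,1], pin 1, two distinct box solutions), **`momentSet_at_geometry_eq_Ioi`** (with (E46a):
    at box 1, floor `s ≥ 2`, the zeroth moments of non-unique instances are EXACTLY `]2(1+s)√(1+s), ∞[`).
-/

noncomputable section
open Filter Topology Finset

namespace Summit.QuantumFields.BalabanUV.Beta.EriceRemainderEnclosureHistoryAutonomyThresholdDiscreteWitness

open Literature.MathematicalPhysics.QuantumFieldTheory.Balaban1983to89
open Literature.MathematicalPhysics.QuantumFieldTheory.Balaban1983to89.T4BetaStationary
open Literature.MathematicalPhysics.QuantumFieldTheory.Balaban1983to89.T4BetaFlowWellPosed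
open Summit.QuantumFields.BalabanUV.Beta.EriceRemainderEnclosureHistoryAutonomyThreshold
open Summit.QuantumFields.BalabanUV.Beta.EriceRemainderEnclosureHistoryAutonomyThresholdDiscrete

variable {s y : ℝ}

/-! ## §1 The tent of height `(1+s)∕y² − (1+s)` centred at `y∕√(1+s)` in the scaled variable `√(1+s)·x` -/

/-- LEFT OF THE SUPPORT: `√(1+s)·x ≤ 2y − 1 ⟹` the tent vanishes (`0 < y`, `0 ≤ 1 + s`). [folklore] -/
theorem tentS_eq_zero_of_le (hs : 0 ≤ 1 + s) (hy0 : 0 < y) {x : ℝ} (hx : Real.sqrt (1 + s) * x ≤ 2 * y - 1) :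
    max ((1 + s) / y ^ 2 - (1 + s) - (1 + s) * (1 + y) / y ^ 2 * |Real.sqrt (1 + s) * x - y|) 0 = 0 := by
  refine max_eq_right ?_
  have h1 : 1 - y ≤ |Real.sqrt (1 + s) * x - y| := by
    rw [abs_sub_comm]; exact (by linarith : 1 - y ≤ y - Real.sqrt (1 + s) * x).trans (le_abs_self _)
  have hK : 0 ≤ (1 + s) * (1 + y) / y ^ 2 := by positivity
  have h2 := mul_le_mul_of_nonneg_left h1 hK
  have e : (1 + s) * (1 + y) / y ^ 2 * (1 - y) = (1 + s) / y ^ 2 - (1 + s) := by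
    field_simp
    ring
  linarith

/-- AT THE RIGHT EDGE `√(1+s)·x = 1` the tent vanishes. [folklore] -/
theorem tentS_eq_zero_of_eq_one (hy0 : 0 < y) (hy1 : y ≤ 1) {x : ℝ} (hx : Real.sqrt (1 + s) * x = 1) :
    max ((1 + s) / y ^ 2 - (1 + s) - (1 + s) * (1 + y) / y ^ 2 * |Real.sqrt (1 + s) * x - y|) 0 = 0 := by
  rw [hx, abs_of_nonneg (by linarith : (0 : ℝ) ≤ 1 - y)]
  have e : (1 + s) / y ^ 2 - (1 + s) - (1 + s) * (1 + y) / y ^ 2 * (1 - y) = 0 := by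
    field_simp
    ring
  rw [e, max_self]

/-- AT THE CENTRE `√(1+s)·x = y` the tent has height `(1+s)∕y² − (1+s) ≥ 0`. [folklore] -/
theorem tentS_eq_of_eq (hs : 0 ≤ 1 + s) (hy0 : 0 < y) (hy1 : y ≤ 1) {x : ℝ} (hx : Real.sqrt (1 + s) * x = y) :
    max ((1 + s) / y ^ 2 - (1 + s) - (1 + s) * (1 + y) / y ^ 2 * |Real.sqrt (1 + s) * x - y|) 0 = (1 + s) / y ^ 2 - (1 + s) := by
  rw [hx, sub_self, abs_zero, mul_zero, sub_zero]
  refine max_eq_left ?_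
  have : y ^ 2 ≤ 1 := by nlinarith
  rw [sub_nonneg, le_div_iff₀ (by positivity)]
  nlinarith

/-- THE TENT IS `(1+s)√(1+s)(1+y)∕y²`-LIPSCHITZ in `x` (`0 ≤ 1 + s`). [folklore] -/
theorem abs_tentS_sub_le (hs : 0 ≤ 1 + s) (hy0 : 0 < y) (x x' : ℝ) :
    |max ((1 + s) / y ^ 2 - (1 + s) - (1 + s) * (1 + y) / y ^ 2 * |Real.sqrt (1 + s) * x - y|) 0
        - max ((1 + s) / y ^ 2 - (1 + s) - (1 + s) * (1 + y) / y ^ 2 * |Real.sqrt (1 + s) * x' - y|) 0|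
      ≤ (1 + s) * Real.sqrt (1 + s) * (1 + y) / y ^ 2 * |x - x'| := by
  refine (abs_max_sub_max_le_abs _ _ _).trans ?_
  have hK : 0 ≤ (1 + s) * (1 + y) / y ^ 2 := by positivity
  rw [show (1 + s) / y ^ 2 - (1 + s) - (1 + s) * (1 + y) / y ^ 2 * |Real.sqrt (1 + s) * x - y|
        - ((1 + s) / y ^ 2 - (1 + s) - (1 + s) * (1 + y) / y ^ 2 * |Real.sqrt (1 + s) * x' - y|)
      = -((1 + s) * (1 + y) / y ^ 2 * (|Real.sqrt (1 + s) * x - y| - |Real.sqrt (1 + s) * x' - y|)) by ring,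
    abs_neg, abs_mul, abs_of_nonneg hK]
  have h1 : |(|Real.sqrt (1 + s) * x - y| - |Real.sqrt (1 + s) * x' - y|)| ≤ Real.sqrt (1 + s) * |x - x'| := by
    refine (abs_abs_sub_abs_le_abs_sub _ _).trans ?_
    rw [show Real.sqrt (1 + s) * x - y - (Real.sqrt (1 + s) * x' - y) = Real.sqrt (1 + s) * (x - x') by ring, abs_mul,
      abs_of_nonneg (Real.sqrt_nonneg _)]
  calc (1 + s) * (1 + y) / y ^ 2 * |(|Real.sqrt (1 + s) * x - y| - |Real.sqrt (1 + s) * x' - y|)|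
      ≤ (1 + s) * (1 + y) / y ^ 2 * (Real.sqrt (1 + s) * |x - x'|) := mul_le_mul_of_nonneg_left h1 hK
    _ = (1 + s) * Real.sqrt (1 + s) * (1 + y) / y ^ 2 * |x - x'| := by ring

/-- THE SCALED HEIGHT of the later solution values: `s ≥ 9∕7`, `w ≥ 1 + 2s`, `y ≥ 9∕10` ⟹ `√(1+s)·(1∕√w) ≤ 2y − 1`
(`(1+s)∕(1+2s) ≤ 16∕25 = (4∕5)²`). [folklore] -/
theorem sqrtS_div_sqrt_le (hs : 9 / 7 ≤ s) {w : ℝ} (hw : 1 + 2 * s ≤ w) (hy : 9 / 10 ≤ y) :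
    Real.sqrt (1 + s) * (1 / Real.sqrt w) ≤ 2 * y - 1 := by
  have hw0 : 0 < w := by linarith
  rw [mul_one_div, ← Real.sqrt_div' (1 + s) hw0.le, Real.sqrt_le_iff]
  refine ⟨by linarith, ?_⟩
  calc (1 + s) / w ≤ (1 + s) / (1 + 2 * s) := div_le_div_of_nonneg_left (by linarith) (by linarith) hw
    _ ≤ 16 / 25 := by rw [div_le_div_iff₀ (by linarith) (by norm_num)]; linarith
    _ ≤ (2 * y - 1) ^ 2 := by nlinarith

/-! ## §2 The Markov tent family at box `1`, floor `s`, pin `1`, and its two box solutions -/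

/-- FLOOR `s`. [folklore] -/
theorem le_tentSφ (s y x : ℝ) :
    s ≤ s + max ((1 + s) / y ^ 2 - (1 + s) - (1 + s) * (1 + y) / y ^ 2 * |Real.sqrt (1 + s) * x - y|) 0 :=
  le_add_of_nonneg_right (le_max_right _ _)

/-- ZEROTH MOMENT ∕ Lipschitz constant `M_{s,y} = (1+s)√(1+s)(1+y)∕y²`. [folklore] -/
theorem abs_tentSφ_sub_le (hs : 0 ≤ 1 + s) (hy0 : 0 < y) (x x' : ℝ) :
    |(s + max ((1 + s) / y ^ 2 - (1 + s) - (1 + s) * (1 + y) / y ^ 2 * |Real.sqrt (1 + s) * x - y|) 0)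
      - (s + max ((1 + s) / y ^ 2 - (1 + s) - (1 + s) * (1 + y) / y ^ 2 * |Real.sqrt (1 + s) * x' - y|) 0)|
      ≤ (1 + s) * Real.sqrt (1 + s) * (1 + y) / y ^ 2 * |x - x'| := by
  rw [add_sub_add_left_eq_sub]
  exact abs_tentS_sub_le hs hy0 x x'

/-- The slow radicand `1 + m·s` at scale `0` … [folklore] -/
theorem radS_zero (s : ℝ) : 1 + (((0 : ℕ) : ℝ)) * s = 1 := by simp

/-- The fast radicand `1 + m·s + ((1+s)∕y² − 1 − s)·min(m,1)` at scale `0` is `1` … [folklore] -/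
theorem radF_zero (s y : ℝ) : 1 + (((0 : ℕ) : ℝ)) * s + ((1 + s) / y ^ 2 - 1 - s) * min (((0 : ℕ) : ℝ)) 1 = 1 := by simp

/-- … and at scale `m+1` it is `(1+s)∕y² + m·s`. [folklore] -/
theorem radF_succ (s y : ℝ) (m : ℕ) :
    1 + (((m + 1 : ℕ) : ℝ)) * s + ((1 + s) / y ^ 2 - 1 - s) * min (((m + 1 : ℕ) : ℝ)) 1 = (1 + s) / y ^ 2 + (m : ℝ) * s := by
  have hmin : min (((m + 1 : ℕ) : ℝ)) 1 = 1 := min_eq_right (by push_cast; linarith [(Nat.cast_nonneg m : (0 : ℝ) ≤ m)])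
  rw [hmin]; push_cast; ring

/-- `1 + s ≤ (1+s)∕y²` for `0 < y ≤ 1`, `0 ≤ 1 + s`. [folklore] -/
theorem one_add_le_div_sq (hs : 0 ≤ 1 + s) (hy0 : 0 < y) (hy1 : y ≤ 1) : 1 + s ≤ (1 + s) / y ^ 2 := by
  rw [le_div_iff₀ (by positivity)]
  have : y ^ 2 ≤ 1 := by nlinarith
  nlinarith

/-- THE SLOW BRANCH `m ↦ 1∕√(1 + m·s)` is box-valued in ]0,1] (`s ≥ 0`). [folklore] -/
theorem seqBox_hS (hs : 0 ≤ s) : SeqBox 1 (fun m : ℕ => (1 : ℝ) / Real.sqrt (1 + (m : ℝ) * s)) := by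
  intro m
  have h1 : 1 ≤ 1 + (m : ℝ) * s := by nlinarith [(Nat.cast_nonneg m : (0 : ℝ) ≤ m)]
  refine ⟨by positivity, ?_⟩
  beta_reduce
  rw [div_le_one (Real.sqrt_pos.2 (by linarith)), Real.le_sqrt' one_pos]
  linarith

/-- THE FAST BRANCH `m ↦ (1 + m·s + ((1+s)∕y² − 1 − s)·min(m,1))^{−1∕2}` is box-valued in ]0,1] (`s ≥ 0`, `0 < y ≤ 1`). [folklore] -/
theorem seqBox_hFs (hs : 0 ≤ s) (hy0 : 0 < y) (hy1 : y ≤ 1) :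
    SeqBox 1 (fun m : ℕ => (1 : ℝ) / Real.sqrt (1 + (m : ℝ) * s + ((1 + s) / y ^ 2 - 1 - s) * min (m : ℝ) 1)) := by
  have hT := one_add_le_div_sq (by linarith : 0 ≤ 1 + s) hy0 hy1
  intro m
  beta_reduce
  cases m with
  | zero => rw [radF_zero, Real.sqrt_one, div_one]; exact ⟨one_pos, le_rfl⟩
  | succ m =>
    rw [radF_succ]
    have h1 : 1 ≤ (1 + s) / y ^ 2 + (m : ℝ) * s := by nlinarith [(Nat.cast_nonneg m : (0 : ℝ) ≤ m)]
    refine ⟨by positivity, ?_⟩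
    rw [div_le_one (Real.sqrt_pos.2 (by linarith)), Real.le_sqrt' one_pos]
    linarith

/-- **THE SLOW BRANCH SOLVES THE TENT FLOW** (`s ≥ 9∕7`, `9∕10 ≤ y ≤ 1`): at scale 1 it sits at the right edge `√(1+s)·h(1) = 1`, afterwards left of
the support. [folklore] -/
theorem memFlow_hS_tentSφ (hs : 9 / 7 ≤ s) (hy0 : 0 < y) (hy9 : 9 / 10 ≤ y) (hy1 : y ≤ 1) :
    MemFlow (fun u : ℕ → ℝ => s + max ((1 + s) / y ^ 2 - (1 + s) - (1 + s) * (1 + y) / y ^ 2 * |Real.sqrt (1 + s) * u 0 - y|) 0) 1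
      (fun m : ℕ => (1 : ℝ) / Real.sqrt (1 + (m : ℝ) * s)) := by
  have hs0 : 0 ≤ s := by linarith
  refine ⟨by beta_reduce; rw [radS_zero, Real.sqrt_one, div_one], fun m => ?_⟩
  beta_reduce
  simp only [add_zero]
  have hR : ∀ n : ℕ, 0 ≤ 1 + (n : ℝ) * s := fun n => by positivity
  rw [one_div_sq_one_div_sqrt (by have := hR (m + 1); positivity), one_div_sq_one_div_sqrt (by have := hR m; positivity)]
  have htent : max ((1 + s) / y ^ 2 - (1 + s) - (1 + s) * (1 + y) / y ^ 2 *
      |Real.sqrt (1 + s) * (1 / Real.sqrt (1 + (((m + 1 : ℕ) : ℝ)) * s)) - y|) 0 = 0 := by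
    cases m with
    | zero =>
      refine tentS_eq_zero_of_eq_one hy0 hy1 ?_
      rw [Nat.cast_one, one_mul, mul_one_div, div_self (Real.sqrt_ne_zero'.2 (by linarith))]
    | succ k =>
      refine tentS_eq_zero_of_le (by linarith) hy0 (sqrtS_div_sqrt_le hs ?_ hy9)
      push_cast; nlinarith [(Nat.cast_nonneg k : (0 : ℝ) ≤ k)]
  rw [htent]
  push_cast
  ring

/-- **THE FAST BRANCH SOLVES THE TENT FLOW** (`s ≥ 9∕7`, `9∕10 ≤ y ≤ 1`): at scale 1 through the PEAK `√(1+s)·h(1) = y`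
(`1∕h(1)² = (1+s)∕y² = 1 + s + height`), afterwards left of the support. [folklore] -/
theorem memFlow_hFs_tentSφ (hs : 9 / 7 ≤ s) (hy0 : 0 < y) (hy9 : 9 / 10 ≤ y) (hy1 : y ≤ 1) :
    MemFlow (fun u : ℕ → ℝ => s + max ((1 + s) / y ^ 2 - (1 + s) - (1 + s) * (1 + y) / y ^ 2 * |Real.sqrt (1 + s) * u 0 - y|) 0) 1
      (fun m : ℕ => (1 : ℝ) / Real.sqrt (1 + (m : ℝ) * s + ((1 + s) / y ^ 2 - 1 - s) * min (m : ℝ) 1)) := by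
  have hs0 : 0 ≤ s := by linarith
  have hT := one_add_le_div_sq (by linarith : 0 ≤ 1 + s) hy0 hy1
  refine ⟨by beta_reduce; rw [radF_zero, Real.sqrt_one, div_one], fun m => ?_⟩
  beta_reduce
  simp only [add_zero]
  cases m with
  | zero =>
    rw [radF_zero, radF_succ, Real.sqrt_one, div_one, one_pow, div_one, Nat.cast_zero, zero_mul, add_zero,
      one_div_sq_one_div_sqrt (by positivity)]
    have hc : Real.sqrt (1 + s) * (1 / Real.sqrt ((1 + s) / y ^ 2)) = y := by
      have hne : Real.sqrt (1 + s) ≠ 0 := Real.sqrt_ne_zero'.2 (by linarith)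
      rw [Real.sqrt_div' (1 + s) (sq_nonneg y), Real.sqrt_sq hy0.le, one_div_div, mul_div_assoc']
      exact mul_div_cancel_left₀ y hne
    rw [tentS_eq_of_eq (by linarith) hy0 hy1 hc]
    ring
  | succ k =>
    rw [radF_succ, radF_succ, one_div_sq_one_div_sqrt (by positivity), one_div_sq_one_div_sqrt (by positivity)]
    have hw : 1 + 2 * s ≤ (1 + s) / y ^ 2 + (((k + 1 : ℕ) : ℝ)) * s := by
      push_cast; nlinarith [(Nat.cast_nonneg k : (0 : ℝ) ≤ k)]
    rw [tentS_eq_zero_of_le (by linarith) hy0 (sqrtS_div_sqrt_le hs hw hy9)]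
    push_cast
    ring

/-- **THE TWO BRANCHES DIFFER** for `y < 1` (at scale 1: `1 + s ≠ (1+s)∕y²`). [folklore] -/
theorem hS_ne_hFs (hs : 0 < 1 + s) (hy0 : 0 < y) (hy1 : y < 1) :
    (fun m : ℕ => (1 : ℝ) / Real.sqrt (1 + (m : ℝ) * s))
      ≠ (fun m : ℕ => (1 : ℝ) / Real.sqrt (1 + (m : ℝ) * s + ((1 + s) / y ^ 2 - 1 - s) * min (m : ℝ) 1)) := by
  intro heq
  have h1 : (fun m : ℕ => (1 : ℝ) / Real.sqrt (1 + (m : ℝ) * s)) 1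
      = (fun m : ℕ => (1 : ℝ) / Real.sqrt (1 + (m : ℝ) * s + ((1 + s) / y ^ 2 - 1 - s) * min (m : ℝ) 1)) 1 := congrFun heq 1
  simp only [Nat.cast_one, one_mul, min_self, mul_one] at h1
  have e2 : 1 + s + ((1 + s) / y ^ 2 - 1 - s) = (1 + s) / y ^ 2 := by ring
  rw [e2] at h1
  have h2 : 1 / (1 / Real.sqrt (1 + s)) ^ 2 = 1 / (1 / Real.sqrt ((1 + s) / y ^ 2)) ^ 2 := by rw [h1]
  rw [one_div_sq_one_div_sqrt hs, one_div_sq_one_div_sqrt (by positivity)] at h2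
  have hy2 : y ^ 2 < 1 := by nlinarith
  have : 1 + s < (1 + s) / y ^ 2 := by rw [lt_div_iff₀ (by positivity)]; nlinarith
  linarith

/-! ## §3 ENDs: the per-geometry threshold `2(1+s)√(1+s)` of (E46a) is exact for every `s ≥ 2` -/

/-- THE PARAMETER CHOICE: for `M′ > 2(1+s)√(1+s)` (`s ≥ 9∕7`) there is `y ∈ [9∕10, 1[` with `(1+s)√(1+s)(1+y)∕y² < M′`. [folklore] -/
theorem moment_lt_of_gt (hs : 9 / 7 ≤ s) {M' : ℝ} (hM' : 2 * ((1 + s) * Real.sqrt (1 + s)) < M') :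
    ∃ y : ℝ, 9 / 10 ≤ y ∧ y < 1 ∧ (1 + s) * Real.sqrt (1 + s) * (1 + y) / y ^ 2 < M' := by
  set A : ℝ := (1 + s) * Real.sqrt (1 + s) with hA
  have hA0 : 0 < A := by positivity
  set κ : ℝ := M' / (2 * A) with hκ
  have hκ1 : 1 < κ := (one_lt_div (by positivity)).2 hM'
  refine ⟨max (9 / 10) (1 - (κ - 1) / 6), le_max_left _ _, max_lt (by norm_num) (by linarith), ?_⟩
  set y : ℝ := max (9 / 10) (1 - (κ - 1) / 6) with hy
  have hy9 : 9 / 10 ≤ y := le_max_left _ _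
  have hyκ : 1 - y ≤ (κ - 1) / 6 := by linarith [le_max_right (9 / 10 : ℝ) (1 - (κ - 1) / 6)]
  have hy0 : 0 < y := by linarith
  have key : 1 + y < 2 * κ * y ^ 2 := by
    nlinarith [mul_nonneg (sub_nonneg.2 hκ1.le) (sq_nonneg y), mul_nonneg (sub_nonneg.2 hy9) (sub_nonneg.2 hκ1.le)]
  have e : M' = 2 * A * κ := by rw [hκ]; field_simp
  rw [e, div_lt_iff₀ (by positivity), show (1 + s) * Real.sqrt (1 + s) * (1 + y) = A * (1 + y) by rw [hA]]
  nlinarith [mul_lt_mul_of_pos_left key hA0]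

/-- **TWO BOX SOLUTIONS AT EVERY GEOMETRY `s ≥ 9∕7` AND EVERY MOMENT ABOVE `2(1+s)√(1+s)`**: a Markov functional `u ↦ φ(u 0)` with `φ`
`L`-Lipschitz on ℝ, `L ≤ M′`, floor `s` — at box `1`, pin `1`, so `bγ² = s`, `M·γ³ = L` — carrying two distinct box solutions. [folklore] -/
theorem exists_two_solutions_at_geometry (hs : 9 / 7 ≤ s) {M' : ℝ} (hM' : 2 * ((1 + s) * Real.sqrt (1 + s)) < M') :
    ∃ (φ : ℝ → ℝ) (L : ℝ) (h h' : ℕ → ℝ),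
      (∀ x x', |φ x - φ x'| ≤ L * |x - x'|) ∧ 0 ≤ L ∧ L < M' ∧ (∀ x, s ≤ φ x) ∧ SeqBox 1 h ∧ SeqBox 1 h' ∧
      MemFlow (fun u => φ (u 0)) 1 h ∧ MemFlow (fun u => φ (u 0)) 1 h' ∧ h ≠ h' := by
  obtain ⟨y, hy9, hy1, hlt⟩ := moment_lt_of_gt hs hM'
  have hy0 : 0 < y := by linarith
  exact ⟨fun x => s + max ((1 + s) / y ^ 2 - (1 + s) - (1 + s) * (1 + y) / y ^ 2 * |Real.sqrt (1 + s) * x - y|) 0,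
    (1 + s) * Real.sqrt (1 + s) * (1 + y) / y ^ 2, _, _,
    fun x x' => abs_tentSφ_sub_le (by linarith) hy0 x x', by positivity, hlt, fun x => le_tentSφ s y x,
    seqBox_hS (by linarith), seqBox_hFs (by linarith) hy0 hy1.le, memFlow_hS_tentSφ hs hy0 hy9 hy1.le,
    memFlow_hFs_tentSφ hs hy0 hy9 hy1.le, hS_ne_hFs (by linarith) hy0 hy1⟩

/-- **THE PER-GEOMETRY THRESHOLD THEOREM (`bγ² = s ≥ 2`, box normalised to `1`).**  The set of zeroth moments `M` of the non-unique instances at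
that geometry — functionals with `|B u − B u′| ≤ M·D` on `D`-close box histories, floor `s` on ]0,1], pin `1`, two distinct box solutions — IS
EXACTLY `]2(1+s)√(1+s), ∞[`: below by (E46a) `memFlow_unique_of_strongAF`, above by the tent family with the moment inflated to `M`. [folklore] -/
theorem momentSet_at_geometry_eq_Ioi (hs : 2 ≤ s) :
    {M : ℝ | ∃ (B : (ℕ → ℝ) → ℝ) (h h' : ℕ → ℝ),
      (∀ u u' : ℕ → ℝ, SeqBox 1 u → SeqBox 1 u' → ∀ D : ℝ, (∀ j, |u j - u' j| ≤ D) → |B u - B u'| ≤ M * D) ∧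
      0 ≤ M ∧ (∀ u, SeqBox 1 u → s ≤ B u) ∧ SeqBox 1 h ∧ SeqBox 1 h' ∧
      MemFlow B 1 h ∧ MemFlow B 1 h' ∧ h ≠ h'} = Set.Ioi (2 * ((1 + s) * Real.sqrt (1 + s))) := by
  have hs0 : 0 < s := by linarith
  ext M
  constructor
  · rintro ⟨B, h, h', hB, hM, hlo, hh, hh', hf, hf', hne⟩
    rw [Set.mem_Ioi]
    by_contra hle'
    have hle := not_lt.1 hle'
    refine hne (memFlow_unique_of_strongAF (γ := 1) (b := s) hB hM one_pos le_rfl hs0 hlo ?_ ?_ hh hh' hf hf')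
    · simpa using hs
    · simpa using hle
  · intro hM
    obtain ⟨φ, L, h, h', hL, hL0, hLM, hlo, hh, hh', hf, hf', hne⟩ :=
      exists_two_solutions_at_geometry (by linarith : (9 : ℝ) / 7 ≤ s) (Set.mem_Ioi.1 hM)
    refine ⟨fun u => φ (u 0), h, h', fun u u' _ _ D hD => ?_, hL0.trans hLM.le, fun u _ => hlo (u 0), hh, hh', hf, hf', hne⟩
    exact (hL (u 0) (u' 0)).trans ((mul_le_mul_of_nonneg_left (hD 0) hL0).trans
      (mul_le_mul_of_nonneg_right hLM.le ((abs_nonneg _).trans (hD 0))))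

end Summit.QuantumFields.BalabanUV.Beta.EriceRemainderEnclosureHistoryAutonomyThresholdDiscreteWitness

end
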